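import Mathlib
import Summits.Ventures.PercRepro2.Defs

/-!
# The four-trace algebra of the two-vertex pendant head (blind cell PercRepro2, night-2 g3;
proofs/NIGHT2-DARC.md §16)

`twoPendant_alg`: the cleared gate functional of the arc `u → w` at a two-vertex pendant head
`P = {w, v}` is nonnegative.  Data: level masses `ℓ₀, ℓ₁, ℓ₂, ℓ₃ ≥ 0` (traces `∅, {v}, {w}, {w, v}`),
reduced avoidance masses `P_i > 0` (and `Q₂, Q₃ > 0` for the pivotal pieces `R_{T∪{u,w}}`,
`R_{T∪{u,w,v}}`), marker masses `A_i, B_i` (and `A_i', B_i'` on the pivotal pieces), product masses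
`C_i` (`C_i'`).  Hypotheses: the inner covariances `≥ 0` (directed BHK in `D₀`), the Lemma-A shift
orderings of the conditional means `x_i = A_i / P_i` along the Boolean lattice `2^{w,v}`,
`ρ_w ≤ ρ_wv` (log-supermodularity of `Z ↦ P(R_Z)`), and THREE positive-association facts of the
TRACE LAW `μ_Z = ℓ_Z P_Z` — (AV-PA) on `{Z ∌ w}` for `(x, y)`, the shifts of `x` and `y` against
`1[w ∈ Z]`, and PA on the whole lattice for the reduced data `x̃ = (x on Z ∌ w, x' on Z ∋ w)` —
in the cleared form produced by `trace_bhk` (functionals `1 − x`, `1 − y`, `1[w ∈ ·]`).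
The proof is the sign argument of NIGHT2-DARC.md §15.7 (a)–(c) in polynomial form: with
`MX = Σ μ_i x_i`, `Λ = Σ μ_i`,
`Λ²·S' = (1 − ρ₃)·N + (ρ₃ − ρ₂)·(N + A₃) + ρ₂·(N + A₂ + A₃)` (Abel summation over the pivotal chain
`{w} ⊂ {w, v}`), where `N ≥ 0` by (AV-PA) on `{Z ∌ w}` plus the two shifts, `N + A₂ + A₃ ≥ 0` by
PA of the reduced data plus `x' ≤ x`, and `A₃ ≥ 0` because `x'_{wv} ≤ x_{wv} = min x ≤ m_X`.
-/

namespace Summit.Ventures.PercRepro2.Coin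

section TwoPendantAlg

variable {R : Type*} [Field R] [LinearOrder R] [IsStrictOrderedRing R]

/-- The non-pivotal block `N` (traces `∅`, `{v}`) is nonnegative: (AV-PA) on `{Z ∌ w}` and the two
shifts (polynomial form; `ν = μ₀ + μ₁`, `Λ = Σ μ`, `MX = Σ μ x`). -/
lemma twoPendant_N_nonneg {μ₀ μ₁ μ₂ μ₃ x₀ x₁ x₂ x₃ y₀ y₁ y₂ y₃ : R}
    (hμ₀ : 0 ≤ μ₀) (hμ₁ : 0 ≤ μ₁)
    (hPAN : ((1 - x₀) * μ₀ + (1 - x₁) * μ₁) * ((1 - y₀) * μ₀ + (1 - y₁) * μ₁) ≤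
      ((1 - x₀) * (1 - y₀) * μ₀ + (1 - x₁) * (1 - y₁) * μ₁) * (μ₀ + μ₁))
    (hshX : ((1 - x₀) * μ₀ + (1 - x₁) * μ₁ + (1 - x₂) * μ₂ + (1 - x₃) * μ₃) * (μ₂ + μ₃) ≤
      ((1 - x₂) * μ₂ + (1 - x₃) * μ₃) * (μ₀ + μ₁ + μ₂ + μ₃))
    (hshY : ((1 - y₀) * μ₀ + (1 - y₁) * μ₁ + (1 - y₂) * μ₂ + (1 - y₃) * μ₃) * (μ₂ + μ₃) ≤
      ((1 - y₂) * μ₂ + (1 - y₃) * μ₃) * (μ₀ + μ₁ + μ₂ + μ₃)) :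
    0 ≤ μ₀ * (x₀ * (μ₀ + μ₁ + μ₂ + μ₃) - (μ₀ * x₀ + μ₁ * x₁ + μ₂ * x₂ + μ₃ * x₃))
          * (y₀ * (μ₀ + μ₁ + μ₂ + μ₃) - (μ₀ * y₀ + μ₁ * y₁ + μ₂ * y₂ + μ₃ * y₃))
        + μ₁ * (x₁ * (μ₀ + μ₁ + μ₂ + μ₃) - (μ₀ * x₀ + μ₁ * x₁ + μ₂ * x₂ + μ₃ * x₃))
          * (y₁ * (μ₀ + μ₁ + μ₂ + μ₃) - (μ₀ * y₀ + μ₁ * y₁ + μ₂ * y₂ + μ₃ * y₃)) := by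
  set Λ := μ₀ + μ₁ + μ₂ + μ₃ with hΛdef
  set ν := μ₀ + μ₁ with hνdef
  set MX := μ₀ * x₀ + μ₁ * x₁ + μ₂ * x₂ + μ₃ * x₃ with hMX
  set MY := μ₀ * y₀ + μ₁ * y₁ + μ₂ * y₂ + μ₃ * y₃ with hMY
  set SX := μ₀ * x₀ + μ₁ * x₁ with hSX
  set SY := μ₀ * y₀ + μ₁ * y₁ with hSY
  set SXY := μ₀ * x₀ * y₀ + μ₁ * x₁ * y₁ with hSXY
  set N := μ₀ * (x₀ * Λ - MX) * (y₀ * Λ - MY) + μ₁ * (x₁ * Λ - MX) * (y₁ * Λ - MY) with hN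
  -- the cleared hypotheses
  have hpa : SX * SY ≤ ν * SXY := by
    have : ((1 - x₀) * μ₀ + (1 - x₁) * μ₁) * ((1 - y₀) * μ₀ + (1 - y₁) * μ₁)
        - ((1 - x₀) * (1 - y₀) * μ₀ + (1 - x₁) * (1 - y₁) * μ₁) * (μ₀ + μ₁)
        = SX * SY - ν * SXY := by
      simp only [hSX, hSY, hSXY, hνdef]; ring
    linarith
  have hsx : MX * ν ≤ SX * Λ := by
    have : ((1 - x₂) * μ₂ + (1 - x₃) * μ₃) * (μ₀ + μ₁ + μ₂ + μ₃)
        - ((1 - x₀) * μ₀ + (1 - x₁) * μ₁ + (1 - x₂) * μ₂ + (1 - x₃) * μ₃) * (μ₂ + μ₃)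
        = SX * Λ - MX * ν := by
      simp only [hSX, hMX, hΛdef, hνdef]; ring
    linarith
  have hsy : MY * ν ≤ SY * Λ := by
    have : ((1 - y₂) * μ₂ + (1 - y₃) * μ₃) * (μ₀ + μ₁ + μ₂ + μ₃)
        - ((1 - y₀) * μ₀ + (1 - y₁) * μ₁ + (1 - y₂) * μ₂ + (1 - y₃) * μ₃) * (μ₂ + μ₃)
        = SY * Λ - MY * ν := by
      simp only [hSY, hMY, hΛdef, hνdef]; ring
    linarith
  -- the key identity: ν·N = Λ²(ν·SXY − SX·SY) + (SX·Λ − MX·ν)(SY·Λ − MY·ν)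
  have key : ν * N = Λ ^ 2 * (ν * SXY - SX * SY) + (SX * Λ - MX * ν) * (SY * Λ - MY * ν) := by
    simp only [hN, hSX, hSY, hSXY, hMX, hMY, hΛdef, hνdef]; ring
  have hνN : 0 ≤ ν * N := by
    rw [key]
    have h1 : 0 ≤ Λ ^ 2 * (ν * SXY - SX * SY) := mul_nonneg (sq_nonneg _) (by linarith)
    have h2 : 0 ≤ (SX * Λ - MX * ν) * (SY * Λ - MY * ν) :=
      mul_nonneg (by linarith) (by linarith)
    linarith
  have hν : 0 ≤ ν := by simp only [hνdef]; linarith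
  rcases hν.eq_or_lt with hν0 | hνpos
  · -- both non-pivotal masses vanish
    have h0 : μ₀ = 0 := by linarith
    have h1 : μ₁ = 0 := by linarith
    simp only [hN, h0, h1, zero_mul, add_zero]
    exact le_refl 0
  · exact (mul_nonneg_iff_of_pos_left hνpos).mp hνN

/-- The reduced block `N + A₂ + A₃` (all four traces with the reduced data `x̃`) is nonnegative:
PA of the trace law for `(x̃, ỹ)` plus `x' ≤ x` (polynomial form). -/
lemma twoPendant_U_nonneg {μ₀ μ₁ μ₂ μ₃ x₀ x₁ x₂ x₃ x₂' x₃' y₀ y₁ y₂ y₃ y₂' y₃' : R}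
    (hμ₂ : 0 ≤ μ₂) (hμ₃ : 0 ≤ μ₃) (hΛ : 0 < μ₀ + μ₁ + μ₂ + μ₃)
    (hx₂ : x₂' ≤ x₂) (hx₃ : x₃' ≤ x₃) (hy₂ : y₂' ≤ y₂) (hy₃ : y₃' ≤ y₃)
    (hPAU : ((1 - x₀) * μ₀ + (1 - x₁) * μ₁ + (1 - x₂') * μ₂ + (1 - x₃') * μ₃) *
        ((1 - y₀) * μ₀ + (1 - y₁) * μ₁ + (1 - y₂') * μ₂ + (1 - y₃') * μ₃) ≤
      ((1 - x₀) * (1 - y₀) * μ₀ + (1 - x₁) * (1 - y₁) * μ₁ + (1 - x₂') * (1 - y₂') * μ₂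
        + (1 - x₃') * (1 - y₃') * μ₃) * (μ₀ + μ₁ + μ₂ + μ₃)) :
    0 ≤ μ₀ * (x₀ * (μ₀ + μ₁ + μ₂ + μ₃) - (μ₀ * x₀ + μ₁ * x₁ + μ₂ * x₂ + μ₃ * x₃))
          * (y₀ * (μ₀ + μ₁ + μ₂ + μ₃) - (μ₀ * y₀ + μ₁ * y₁ + μ₂ * y₂ + μ₃ * y₃))
        + μ₁ * (x₁ * (μ₀ + μ₁ + μ₂ + μ₃) - (μ₀ * x₀ + μ₁ * x₁ + μ₂ * x₂ + μ₃ * x₃))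
          * (y₁ * (μ₀ + μ₁ + μ₂ + μ₃) - (μ₀ * y₀ + μ₁ * y₁ + μ₂ * y₂ + μ₃ * y₃))
        + μ₂ * (x₂' * (μ₀ + μ₁ + μ₂ + μ₃) - (μ₀ * x₀ + μ₁ * x₁ + μ₂ * x₂ + μ₃ * x₃))
          * (y₂' * (μ₀ + μ₁ + μ₂ + μ₃) - (μ₀ * y₀ + μ₁ * y₁ + μ₂ * y₂ + μ₃ * y₃))
        + μ₃ * (x₃' * (μ₀ + μ₁ + μ₂ + μ₃) - (μ₀ * x₀ + μ₁ * x₁ + μ₂ * x₂ + μ₃ * x₃))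
          * (y₃' * (μ₀ + μ₁ + μ₂ + μ₃) - (μ₀ * y₀ + μ₁ * y₁ + μ₂ * y₂ + μ₃ * y₃)) := by
  set Λ := μ₀ + μ₁ + μ₂ + μ₃ with hΛdef
  set MX := μ₀ * x₀ + μ₁ * x₁ + μ₂ * x₂ + μ₃ * x₃ with hMX
  set MY := μ₀ * y₀ + μ₁ * y₁ + μ₂ * y₂ + μ₃ * y₃ with hMY
  set TX := μ₀ * x₀ + μ₁ * x₁ + μ₂ * x₂' + μ₃ * x₃' with hTX
  set TY := μ₀ * y₀ + μ₁ * y₁ + μ₂ * y₂' + μ₃ * y₃' with hTY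
  set TXY := μ₀ * x₀ * y₀ + μ₁ * x₁ * y₁ + μ₂ * x₂' * y₂' + μ₃ * x₃' * y₃' with hTXY
  have hpa : TX * TY ≤ Λ * TXY := by
    have : ((1 - x₀) * μ₀ + (1 - x₁) * μ₁ + (1 - x₂') * μ₂ + (1 - x₃') * μ₃) *
        ((1 - y₀) * μ₀ + (1 - y₁) * μ₁ + (1 - y₂') * μ₂ + (1 - y₃') * μ₃)
        - ((1 - x₀) * (1 - y₀) * μ₀ + (1 - x₁) * (1 - y₁) * μ₁ + (1 - x₂') * (1 - y₂') * μ₂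
          + (1 - x₃') * (1 - y₃') * μ₃) * (μ₀ + μ₁ + μ₂ + μ₃)
        = TX * TY - Λ * TXY := by
      simp only [hTX, hTY, hTXY, hΛdef]; ring
    linarith
  have hTXle : TX - MX ≤ 0 := by
    have : TX - MX = μ₂ * (x₂' - x₂) + μ₃ * (x₃' - x₃) := by simp only [hTX, hMX]; ring
    rw [this]
    have h2 : μ₂ * (x₂' - x₂) ≤ 0 := mul_nonpos_of_nonneg_of_nonpos hμ₂ (by linarith)
    have h3 : μ₃ * (x₃' - x₃) ≤ 0 := mul_nonpos_of_nonneg_of_nonpos hμ₃ (by linarith)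
    linarith
  have hTYle : TY - MY ≤ 0 := by
    have : TY - MY = μ₂ * (y₂' - y₂) + μ₃ * (y₃' - y₃) := by simp only [hTY, hMY]; ring
    rw [this]
    have h2 : μ₂ * (y₂' - y₂) ≤ 0 := mul_nonpos_of_nonneg_of_nonpos hμ₂ (by linarith)
    have h3 : μ₃ * (y₃' - y₃) ≤ 0 := mul_nonpos_of_nonneg_of_nonpos hμ₃ (by linarith)
    linarith
  -- the key identity: G = Λ·(Λ·TXY − TX·TY) + Λ·(TX − MX)·(TY − MY)
  have key : μ₀ * (x₀ * Λ - MX) * (y₀ * Λ - MY) + μ₁ * (x₁ * Λ - MX) * (y₁ * Λ - MY)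
        + μ₂ * (x₂' * Λ - MX) * (y₂' * Λ - MY) + μ₃ * (x₃' * Λ - MX) * (y₃' * Λ - MY)
      = Λ * (Λ * TXY - TX * TY) + Λ * ((TX - MX) * (TY - MY)) := by
    simp only [hTX, hTY, hTXY, hMX, hMY, hΛdef]; ring
  rw [key]
  have h1 : 0 ≤ Λ * (Λ * TXY - TX * TY) := mul_nonneg hΛ.le (by linarith)
  have h2 : 0 ≤ Λ * ((TX - MX) * (TY - MY)) :=
    mul_nonneg hΛ.le (mul_nonneg_of_nonpos_of_nonpos hTXle hTYle)
  linarith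

omit [LinearOrder R] [IsStrictOrderedRing R] in
/-- The gate functional in polynomial form, with `Λ`, `MX`, `MY` as atoms: it is
`Λ²·(inner covariances) + (N + ρ₂·A₂ + ρ₃·A₃)` (pure `ring`). -/
lemma twoPendant_goal_identity (ℓ₀ ℓ₁ ℓ₂ ℓ₃ P₀ P₁ P₂ P₃ ρ₂ ρ₃ x₀ x₁ x₂' x₃' y₀ y₁ y₂' y₃'
    c₀ c₁ c₂ c₃ Λ MX MY : R) :
    Λ ^ 2
        * (ℓ₀ * ((c₀ + x₀ * y₀) * P₀) + ℓ₁ * ((c₁ + x₁ * y₁) * P₁)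
          + ℓ₂ * ((c₂ + x₂' * y₂') * (ρ₂ * P₂)) + ℓ₃ * ((c₃ + x₃' * y₃') * (ρ₃ * P₃)))
      - Λ * MX
          * (ℓ₀ * (y₀ * P₀) + ℓ₁ * (y₁ * P₁) + ℓ₂ * (y₂' * (ρ₂ * P₂)) + ℓ₃ * (y₃' * (ρ₃ * P₃)))
      - Λ * MY
          * (ℓ₀ * (x₀ * P₀) + ℓ₁ * (x₁ * P₁) + ℓ₂ * (x₂' * (ρ₂ * P₂)) + ℓ₃ * (x₃' * (ρ₃ * P₃)))
      + MX * MY * (ℓ₀ * P₀ + ℓ₁ * P₁ + ℓ₂ * (ρ₂ * P₂) + ℓ₃ * (ρ₃ * P₃))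
      = Λ ^ 2 * (ℓ₀ * P₀ * c₀ + ℓ₁ * P₁ * c₁ + ρ₂ * (ℓ₂ * P₂) * c₂ + ρ₃ * (ℓ₃ * P₃) * c₃)
        + ((ℓ₀ * P₀ * (x₀ * Λ - MX) * (y₀ * Λ - MY) + ℓ₁ * P₁ * (x₁ * Λ - MX) * (y₁ * Λ - MY)) + ρ₂ * (ℓ₂ * P₂ * (x₂' * Λ - MX) * (y₂' * Λ - MY)) + ρ₃ * (ℓ₃ * P₃ * (x₃' * Λ - MX) * (y₃' * Λ - MY))) := by
  ring

/-- The Abel summation over the pivotal chain `{w} ⊂ {w, v}`: from the three block signs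
(`N ≥ 0`, `N + A₂ + A₃ ≥ 0`, `A₃ ≥ 0`) and `0 ≤ ρ₂ ≤ ρ₃ ≤ 1`, `N + ρ₂·A₂ + ρ₃·A₃ ≥ 0`. -/
lemma twoPendant_abel {N A₂ A₃ ρ₂ ρ₃ : R} (hρ₂ : 0 ≤ ρ₂) (hρ₂₃ : ρ₂ ≤ ρ₃) (hρ₃ : ρ₃ ≤ 1)
    (hN : 0 ≤ N) (hU : 0 ≤ N + A₂ + A₃) (hA₃ : 0 ≤ A₃) : 0 ≤ N + ρ₂ * A₂ + ρ₃ * A₃ := by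
  have e : N + ρ₂ * A₂ + ρ₃ * A₃ = (1 - ρ₃) * N + (ρ₃ - ρ₂) * (N + A₃) + ρ₂ * (N + A₂ + A₃) := by
    ring
  rw [e]
  have h1 : 0 ≤ (1 - ρ₃) * N := mul_nonneg (by linarith only [hρ₃]) hN
  have h2 : 0 ≤ (ρ₃ - ρ₂) * (N + A₃) := mul_nonneg (by linarith only [hρ₂₃]) (by linarith only [hN, hA₃])
  have h3 : 0 ≤ ρ₂ * (N + A₂ + A₃) := mul_nonneg hρ₂ hU
  linarith only [h1, h2, h3]

/-- The top pivotal block `A₃ ≥ 0`: `x'_{wv} ≤ x_{wv} = min x ≤ m_X` and likewise for `y`. -/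
lemma twoPendant_A₃_nonneg {μ₀ μ₁ μ₂ μ₃ x₀ x₁ x₂ x₃ x₃' y₀ y₁ y₂ y₃ y₃' Λ MX MY : R}
    (hμ₀ : 0 ≤ μ₀) (hμ₁ : 0 ≤ μ₁) (hμ₂ : 0 ≤ μ₂) (hμ₃ : 0 ≤ μ₃) (hΛ : 0 < Λ)
    (hΛe : Λ = μ₀ + μ₁ + μ₂ + μ₃) (hMXe : MX = μ₀ * x₀ + μ₁ * x₁ + μ₂ * x₂ + μ₃ * x₃)
    (hMYe : MY = μ₀ * y₀ + μ₁ * y₁ + μ₂ * y₂ + μ₃ * y₃)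
    (hx₃₀ : x₃ ≤ x₀) (hx₃₁ : x₃ ≤ x₁) (hx₃₂ : x₃ ≤ x₂) (hx₃' : x₃' ≤ x₃)
    (hy₃₀ : y₃ ≤ y₀) (hy₃₁ : y₃ ≤ y₁) (hy₃₂ : y₃ ≤ y₂) (hy₃' : y₃' ≤ y₃) :
    0 ≤ μ₃ * (x₃' * Λ - MX) * (y₃' * Λ - MY) := by
  have hxm : x₃' * Λ - MX ≤ 0 := by
    have e : x₃ * Λ - MX = μ₀ * (x₃ - x₀) + μ₁ * (x₃ - x₁) + μ₂ * (x₃ - x₂) := by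
      rw [hΛe, hMXe]; ring
    have h0 : μ₀ * (x₃ - x₀) ≤ 0 := mul_nonpos_of_nonneg_of_nonpos hμ₀ (by linarith only [hx₃₀])
    have h1 : μ₁ * (x₃ - x₁) ≤ 0 := mul_nonpos_of_nonneg_of_nonpos hμ₁ (by linarith only [hx₃₁])
    have h2 : μ₂ * (x₃ - x₂) ≤ 0 := mul_nonpos_of_nonneg_of_nonpos hμ₂ (by linarith only [hx₃₂])
    have h3 : x₃' * Λ ≤ x₃ * Λ := mul_le_mul_of_nonneg_right hx₃' hΛ.le
    linarith only [e, h0, h1, h2, h3]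
  have hym : y₃' * Λ - MY ≤ 0 := by
    have e : y₃ * Λ - MY = μ₀ * (y₃ - y₀) + μ₁ * (y₃ - y₁) + μ₂ * (y₃ - y₂) := by
      rw [hΛe, hMYe]; ring
    have h0 : μ₀ * (y₃ - y₀) ≤ 0 := mul_nonpos_of_nonneg_of_nonpos hμ₀ (by linarith only [hy₃₀])
    have h1 : μ₁ * (y₃ - y₁) ≤ 0 := mul_nonpos_of_nonneg_of_nonpos hμ₁ (by linarith only [hy₃₁])
    have h2 : μ₂ * (y₃ - y₂) ≤ 0 := mul_nonpos_of_nonneg_of_nonpos hμ₂ (by linarith only [hy₃₂])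
    have h3 : y₃' * Λ ≤ y₃ * Λ := mul_le_mul_of_nonneg_right hy₃' hΛ.le
    linarith only [e, h0, h1, h2, h3]
  exact mul_nonneg_of_nonpos_of_nonpos (mul_nonpos_of_nonneg_of_nonpos hμ₃ hxm) hym

/-- **The four-trace algebra, polynomial core**: conditional means `x_i`, reduced means
`x_i'`, covariances `c_i`, pivotal weights `ρ_i` already substituted. -/
theorem twoPendant_core {ℓ₀ ℓ₁ ℓ₂ ℓ₃ P₀ P₁ P₂ P₃ ρ₂ ρ₃ x₀ x₁ x₂ x₃ x₂' x₃' y₀ y₁ y₂ y₃ y₂' y₃'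
    c₀ c₁ c₂ c₃ : R}
    (hℓ₀ : 0 ≤ ℓ₀) (hℓ₁ : 0 ≤ ℓ₁) (hℓ₂ : 0 ≤ ℓ₂) (hℓ₃ : 0 ≤ ℓ₃)
    (hP₀ : 0 < P₀) (hP₁ : 0 < P₁) (hP₂ : 0 < P₂) (hP₃ : 0 < P₃)
    (hΛ : 0 < ℓ₀ * P₀ + ℓ₁ * P₁ + ℓ₂ * P₂ + ℓ₃ * P₃)
    (hρ₂n : 0 ≤ ρ₂) (hρ₂₃ : ρ₂ ≤ ρ₃) (hρ₃₁ : ρ₃ ≤ 1)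
    (hc₀ : 0 ≤ c₀) (hc₁ : 0 ≤ c₁) (hc₂ : 0 ≤ c₂) (hc₃ : 0 ≤ c₃)
    (hx₂₀ : x₂ ≤ x₀) (hx₃₁ : x₃ ≤ x₁) (hx₃₂ : x₃ ≤ x₂)
    (hx₂'₂ : x₂' ≤ x₂) (hx₃'₃ : x₃' ≤ x₃)
    (hy₂₀ : y₂ ≤ y₀) (hy₃₁ : y₃ ≤ y₁) (hy₃₂ : y₃ ≤ y₂)
    (hy₂'₂ : y₂' ≤ y₂) (hy₃'₃ : y₃' ≤ y₃)
    (hPAN : ((1 - x₀) * (ℓ₀ * P₀) + (1 - x₁) * (ℓ₁ * P₁)) *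
        ((1 - y₀) * (ℓ₀ * P₀) + (1 - y₁) * (ℓ₁ * P₁)) ≤
      ((1 - x₀) * (1 - y₀) * (ℓ₀ * P₀) + (1 - x₁) * (1 - y₁) * (ℓ₁ * P₁)) * (ℓ₀ * P₀ + ℓ₁ * P₁))
    (hshA : ((1 - x₀) * (ℓ₀ * P₀) + (1 - x₁) * (ℓ₁ * P₁) + (1 - x₂) * (ℓ₂ * P₂)
        + (1 - x₃) * (ℓ₃ * P₃)) * (ℓ₂ * P₂ + ℓ₃ * P₃) ≤
      ((1 - x₂) * (ℓ₂ * P₂) + (1 - x₃) * (ℓ₃ * P₃)) * (ℓ₀ * P₀ + ℓ₁ * P₁ + ℓ₂ * P₂ + ℓ₃ * P₃))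
    (hshB : ((1 - y₀) * (ℓ₀ * P₀) + (1 - y₁) * (ℓ₁ * P₁) + (1 - y₂) * (ℓ₂ * P₂)
        + (1 - y₃) * (ℓ₃ * P₃)) * (ℓ₂ * P₂ + ℓ₃ * P₃) ≤
      ((1 - y₂) * (ℓ₂ * P₂) + (1 - y₃) * (ℓ₃ * P₃)) * (ℓ₀ * P₀ + ℓ₁ * P₁ + ℓ₂ * P₂ + ℓ₃ * P₃))
    (hPAU : ((1 - x₀) * (ℓ₀ * P₀) + (1 - x₁) * (ℓ₁ * P₁) + (1 - x₂') * (ℓ₂ * P₂)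
        + (1 - x₃') * (ℓ₃ * P₃)) *
        ((1 - y₀) * (ℓ₀ * P₀) + (1 - y₁) * (ℓ₁ * P₁) + (1 - y₂') * (ℓ₂ * P₂)
        + (1 - y₃') * (ℓ₃ * P₃)) ≤
      ((1 - x₀) * (1 - y₀) * (ℓ₀ * P₀) + (1 - x₁) * (1 - y₁) * (ℓ₁ * P₁)
        + (1 - x₂') * (1 - y₂') * (ℓ₂ * P₂) + (1 - x₃') * (1 - y₃') * (ℓ₃ * P₃)) *
        (ℓ₀ * P₀ + ℓ₁ * P₁ + ℓ₂ * P₂ + ℓ₃ * P₃)) :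
    0 ≤ (ℓ₀ * P₀ + ℓ₁ * P₁ + ℓ₂ * P₂ + ℓ₃ * P₃) ^ 2
        * (ℓ₀ * ((c₀ + x₀ * y₀) * P₀) + ℓ₁ * ((c₁ + x₁ * y₁) * P₁)
          + ℓ₂ * ((c₂ + x₂' * y₂') * (ρ₂ * P₂)) + ℓ₃ * ((c₃ + x₃' * y₃') * (ρ₃ * P₃)))
      - (ℓ₀ * P₀ + ℓ₁ * P₁ + ℓ₂ * P₂ + ℓ₃ * P₃)
          * (ℓ₀ * (x₀ * P₀) + ℓ₁ * (x₁ * P₁) + ℓ₂ * (x₂ * P₂) + ℓ₃ * (x₃ * P₃))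
          * (ℓ₀ * (y₀ * P₀) + ℓ₁ * (y₁ * P₁) + ℓ₂ * (y₂' * (ρ₂ * P₂)) + ℓ₃ * (y₃' * (ρ₃ * P₃)))
      - (ℓ₀ * P₀ + ℓ₁ * P₁ + ℓ₂ * P₂ + ℓ₃ * P₃)
          * (ℓ₀ * (y₀ * P₀) + ℓ₁ * (y₁ * P₁) + ℓ₂ * (y₂ * P₂) + ℓ₃ * (y₃ * P₃))
          * (ℓ₀ * (x₀ * P₀) + ℓ₁ * (x₁ * P₁) + ℓ₂ * (x₂' * (ρ₂ * P₂)) + ℓ₃ * (x₃' * (ρ₃ * P₃)))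
      + (ℓ₀ * (x₀ * P₀) + ℓ₁ * (x₁ * P₁) + ℓ₂ * (x₂ * P₂) + ℓ₃ * (x₃ * P₃))
          * (ℓ₀ * (y₀ * P₀) + ℓ₁ * (y₁ * P₁) + ℓ₂ * (y₂ * P₂) + ℓ₃ * (y₃ * P₃))
          * (ℓ₀ * P₀ + ℓ₁ * P₁ + ℓ₂ * (ρ₂ * P₂) + ℓ₃ * (ρ₃ * P₃)) := by
  have hμ₀n : 0 ≤ ℓ₀ * P₀ := mul_nonneg hℓ₀ hP₀.le
  have hμ₁n : 0 ≤ ℓ₁ * P₁ := mul_nonneg hℓ₁ hP₁.le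
  have hμ₂n : 0 ≤ ℓ₂ * P₂ := mul_nonneg hℓ₂ hP₂.le
  have hμ₃n : 0 ≤ ℓ₃ * P₃ := mul_nonneg hℓ₃ hP₃.le
  obtain ⟨Λ, hΛe⟩ : ∃ L : R, L = ℓ₀ * P₀ + ℓ₁ * P₁ + ℓ₂ * P₂ + ℓ₃ * P₃ := ⟨_, rfl⟩
  obtain ⟨MX, hMXe⟩ : ∃ M : R,
    M = ℓ₀ * P₀ * x₀ + ℓ₁ * P₁ * x₁ + ℓ₂ * P₂ * x₂ + ℓ₃ * P₃ * x₃ := ⟨_, rfl⟩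
  obtain ⟨MY, hMYe⟩ : ∃ M : R,
    M = ℓ₀ * P₀ * y₀ + ℓ₁ * P₁ * y₁ + ℓ₂ * P₂ * y₂ + ℓ₃ * P₃ * y₃ := ⟨_, rfl⟩
  have hΛpos : 0 < Λ := by rw [hΛe]; exact hΛ
  -- the three blocks
  have hNn : 0 ≤ ℓ₀ * P₀ * (x₀ * Λ - MX) * (y₀ * Λ - MY) + ℓ₁ * P₁ * (x₁ * Λ - MX) * (y₁ * Λ - MY) := by
    rw [hΛe, hMXe, hMYe]
    exact twoPendant_N_nonneg hμ₀n hμ₁n hPAN hshA hshB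
  have hUn : 0 ≤ ℓ₀ * P₀ * (x₀ * Λ - MX) * (y₀ * Λ - MY) + ℓ₁ * P₁ * (x₁ * Λ - MX) * (y₁ * Λ - MY) + ℓ₂ * P₂ * (x₂' * Λ - MX) * (y₂' * Λ - MY) + ℓ₃ * P₃ * (x₃' * Λ - MX) * (y₃' * Λ - MY) := by
    rw [hΛe, hMXe, hMYe]
    exact twoPendant_U_nonneg hμ₂n hμ₃n hΛ hx₂'₂ hx₃'₃ hy₂'₂ hy₃'₃ hPAU
  have hA₃n : 0 ≤ ℓ₃ * P₃ * (x₃' * Λ - MX) * (y₃' * Λ - MY) :=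
    twoPendant_A₃_nonneg hμ₀n hμ₁n hμ₂n hμ₃n hΛpos hΛe hMXe hMYe
      (le_trans hx₃₂ hx₂₀) hx₃₁ hx₃₂ hx₃'₃ (le_trans hy₃₂ hy₂₀) hy₃₁ hy₃₂ hy₃'₃
  have hS := twoPendant_abel hρ₂n hρ₂₃ hρ₃₁ hNn hUn hA₃n
  have hcovs : 0 ≤ ℓ₀ * P₀ * c₀ + ℓ₁ * P₁ * c₁ + ρ₂ * (ℓ₂ * P₂) * c₂ + ρ₃ * (ℓ₃ * P₃) * c₃ := by
    have h0 : 0 ≤ ℓ₀ * P₀ * c₀ := mul_nonneg hμ₀n hc₀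
    have h1 : 0 ≤ ℓ₁ * P₁ * c₁ := mul_nonneg hμ₁n hc₁
    have h2 : 0 ≤ ρ₂ * (ℓ₂ * P₂) * c₂ := mul_nonneg (mul_nonneg hρ₂n hμ₂n) hc₂
    have h3 : 0 ≤ ρ₃ * (ℓ₃ * P₃) * c₃ :=
      mul_nonneg (mul_nonneg (by linarith only [hρ₂n, hρ₂₃]) hμ₃n) hc₃
    linarith only [h0, h1, h2, h3]
  have hmain := add_nonneg (mul_nonneg (sq_nonneg Λ) hcovs) hS
  -- fold the goal's sums into `Λ`, `MX`, `MY`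
  have hMXg : ℓ₀ * (x₀ * P₀) + ℓ₁ * (x₁ * P₁) + ℓ₂ * (x₂ * P₂) + ℓ₃ * (x₃ * P₃) = MX := by
    rw [hMXe]; ring
  have hMYg : ℓ₀ * (y₀ * P₀) + ℓ₁ * (y₁ * P₁) + ℓ₂ * (y₂ * P₂) + ℓ₃ * (y₃ * P₃) = MY := by
    rw [hMYe]; ring
  rw [hMXg, hMYg, ← hΛe, twoPendant_goal_identity]
  exact hmain

/-- **The four-trace algebra of the two-vertex pendant head.** See the module docstring for the
data; the conclusion is the cleared gate functional
`Λ²·C_E − Λ·A·B_E − Λ·B·A_E + A·B·P_E ≥ 0` with `Λ = Σ ℓ_i P_i`, `A = Σ ℓ_i A_i`, `B = Σ ℓ_i B_i`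
(masses on `R_T`) and `P_E, A_E, B_E, C_E` the masses on the gate pieces (levels 0, 1 unchanged,
levels 2, 3 replaced by the pivotal pieces `Q, A', B', C'`). -/
theorem twoPendant_alg {ℓ₀ ℓ₁ ℓ₂ ℓ₃ P₀ P₁ P₂ P₃ Q₂ Q₃ A₀ A₁ A₂ A₃ A₂' A₃' B₀ B₁ B₂ B₃ B₂' B₃'
    C₀ C₁ C₂' C₃' : R}
    (hℓ₀ : 0 ≤ ℓ₀) (hℓ₁ : 0 ≤ ℓ₁) (hℓ₂ : 0 ≤ ℓ₂) (hℓ₃ : 0 ≤ ℓ₃)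
    (hP₀ : 0 < P₀) (hP₁ : 0 < P₁) (hP₂ : 0 < P₂) (hP₃ : 0 < P₃) (hQ₂ : 0 < Q₂) (hQ₃ : 0 < Q₃)
    (hΛ : 0 < ℓ₀ * P₀ + ℓ₁ * P₁ + ℓ₂ * P₂ + ℓ₃ * P₃)
    (hQ₃P : Q₃ ≤ P₃) (hρ : Q₂ * P₃ ≤ P₂ * Q₃)
    (hcov₀ : 0 ≤ P₀ * C₀ - A₀ * B₀) (hcov₁ : 0 ≤ P₁ * C₁ - A₁ * B₁)
    (hcov₂' : 0 ≤ Q₂ * C₂' - A₂' * B₂') (hcov₃' : 0 ≤ Q₃ * C₃' - A₃' * B₃')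
    (hA₀₂ : A₂ * P₀ ≤ A₀ * P₂) (hA₁₃ : A₃ * P₁ ≤ A₁ * P₃)
    (hA₂₃ : A₃ * P₂ ≤ A₂ * P₃) (hA₂' : A₂' * P₂ ≤ A₂ * Q₂) (hA₃' : A₃' * P₃ ≤ A₃ * Q₃)
    (hB₀₂ : B₂ * P₀ ≤ B₀ * P₂) (hB₁₃ : B₃ * P₁ ≤ B₁ * P₃)
    (hB₂₃ : B₃ * P₂ ≤ B₂ * P₃) (hB₂' : B₂' * P₂ ≤ B₂ * Q₂) (hB₃' : B₃' * P₃ ≤ B₃ * Q₃)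
    (hPAN : ((1 - A₀ / P₀) * (ℓ₀ * P₀) + (1 - A₁ / P₁) * (ℓ₁ * P₁)) *
        ((1 - B₀ / P₀) * (ℓ₀ * P₀) + (1 - B₁ / P₁) * (ℓ₁ * P₁)) ≤
      ((1 - A₀ / P₀) * (1 - B₀ / P₀) * (ℓ₀ * P₀) + (1 - A₁ / P₁) * (1 - B₁ / P₁) * (ℓ₁ * P₁)) *
        (ℓ₀ * P₀ + ℓ₁ * P₁))
    (hshA : ((1 - A₀ / P₀) * (ℓ₀ * P₀) + (1 - A₁ / P₁) * (ℓ₁ * P₁) + (1 - A₂ / P₂) * (ℓ₂ * P₂)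
        + (1 - A₃ / P₃) * (ℓ₃ * P₃)) * (ℓ₂ * P₂ + ℓ₃ * P₃) ≤
      ((1 - A₂ / P₂) * (ℓ₂ * P₂) + (1 - A₃ / P₃) * (ℓ₃ * P₃)) *
        (ℓ₀ * P₀ + ℓ₁ * P₁ + ℓ₂ * P₂ + ℓ₃ * P₃))
    (hshB : ((1 - B₀ / P₀) * (ℓ₀ * P₀) + (1 - B₁ / P₁) * (ℓ₁ * P₁) + (1 - B₂ / P₂) * (ℓ₂ * P₂)
        + (1 - B₃ / P₃) * (ℓ₃ * P₃)) * (ℓ₂ * P₂ + ℓ₃ * P₃) ≤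
      ((1 - B₂ / P₂) * (ℓ₂ * P₂) + (1 - B₃ / P₃) * (ℓ₃ * P₃)) *
        (ℓ₀ * P₀ + ℓ₁ * P₁ + ℓ₂ * P₂ + ℓ₃ * P₃))
    (hPAU : ((1 - A₀ / P₀) * (ℓ₀ * P₀) + (1 - A₁ / P₁) * (ℓ₁ * P₁) + (1 - A₂' / Q₂) * (ℓ₂ * P₂)
        + (1 - A₃' / Q₃) * (ℓ₃ * P₃)) *
        ((1 - B₀ / P₀) * (ℓ₀ * P₀) + (1 - B₁ / P₁) * (ℓ₁ * P₁) + (1 - B₂' / Q₂) * (ℓ₂ * P₂)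
        + (1 - B₃' / Q₃) * (ℓ₃ * P₃)) ≤
      ((1 - A₀ / P₀) * (1 - B₀ / P₀) * (ℓ₀ * P₀) + (1 - A₁ / P₁) * (1 - B₁ / P₁) * (ℓ₁ * P₁)
        + (1 - A₂' / Q₂) * (1 - B₂' / Q₂) * (ℓ₂ * P₂)
        + (1 - A₃' / Q₃) * (1 - B₃' / Q₃) * (ℓ₃ * P₃)) *
        (ℓ₀ * P₀ + ℓ₁ * P₁ + ℓ₂ * P₂ + ℓ₃ * P₃)) :
    0 ≤ (ℓ₀ * P₀ + ℓ₁ * P₁ + ℓ₂ * P₂ + ℓ₃ * P₃) ^ 2 * (ℓ₀ * C₀ + ℓ₁ * C₁ + ℓ₂ * C₂' + ℓ₃ * C₃')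
      - (ℓ₀ * P₀ + ℓ₁ * P₁ + ℓ₂ * P₂ + ℓ₃ * P₃) * (ℓ₀ * A₀ + ℓ₁ * A₁ + ℓ₂ * A₂ + ℓ₃ * A₃)
          * (ℓ₀ * B₀ + ℓ₁ * B₁ + ℓ₂ * B₂' + ℓ₃ * B₃')
      - (ℓ₀ * P₀ + ℓ₁ * P₁ + ℓ₂ * P₂ + ℓ₃ * P₃) * (ℓ₀ * B₀ + ℓ₁ * B₁ + ℓ₂ * B₂ + ℓ₃ * B₃)
          * (ℓ₀ * A₀ + ℓ₁ * A₁ + ℓ₂ * A₂' + ℓ₃ * A₃')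
      + (ℓ₀ * A₀ + ℓ₁ * A₁ + ℓ₂ * A₂ + ℓ₃ * A₃) * (ℓ₀ * B₀ + ℓ₁ * B₁ + ℓ₂ * B₂ + ℓ₃ * B₃)
          * (ℓ₀ * P₀ + ℓ₁ * P₁ + ℓ₂ * Q₂ + ℓ₃ * Q₃) := by
  -- conditional means `x_i = A_i / P_i`, substituted everywhere
  obtain ⟨x₀, hx₀⟩ : ∃ x : R, A₀ / P₀ = x := ⟨_, rfl⟩
  obtain ⟨x₁, hx₁⟩ : ∃ x : R, A₁ / P₁ = x := ⟨_, rfl⟩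
  obtain ⟨x₂, hx₂⟩ : ∃ x : R, A₂ / P₂ = x := ⟨_, rfl⟩
  obtain ⟨x₃, hx₃⟩ : ∃ x : R, A₃ / P₃ = x := ⟨_, rfl⟩
  obtain ⟨x₂', hx₂'⟩ : ∃ x : R, A₂' / Q₂ = x := ⟨_, rfl⟩
  obtain ⟨x₃', hx₃'⟩ : ∃ x : R, A₃' / Q₃ = x := ⟨_, rfl⟩
  obtain ⟨y₀, hy₀⟩ : ∃ x : R, B₀ / P₀ = x := ⟨_, rfl⟩
  obtain ⟨y₁, hy₁⟩ : ∃ x : R, B₁ / P₁ = x := ⟨_, rfl⟩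
  obtain ⟨y₂, hy₂⟩ : ∃ x : R, B₂ / P₂ = x := ⟨_, rfl⟩
  obtain ⟨y₃, hy₃⟩ : ∃ x : R, B₃ / P₃ = x := ⟨_, rfl⟩
  obtain ⟨y₂', hy₂'⟩ : ∃ x : R, B₂' / Q₂ = x := ⟨_, rfl⟩
  obtain ⟨y₃', hy₃'⟩ : ∃ x : R, B₃' / Q₃ = x := ⟨_, rfl⟩
  rw [hx₀, hx₁, hy₀, hy₁] at hPAN
  rw [hx₀, hx₁, hx₂, hx₃] at hshA
  rw [hy₀, hy₁, hy₂, hy₃] at hshB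
  rw [hx₀, hx₁, hx₂', hx₃', hy₀, hy₁, hy₂', hy₃'] at hPAU
  have eA₀ : A₀ = x₀ * P₀ := by rw [← hx₀, div_mul_cancel₀ _ hP₀.ne']
  have eA₁ : A₁ = x₁ * P₁ := by rw [← hx₁, div_mul_cancel₀ _ hP₁.ne']
  have eA₂ : A₂ = x₂ * P₂ := by rw [← hx₂, div_mul_cancel₀ _ hP₂.ne']
  have eA₃ : A₃ = x₃ * P₃ := by rw [← hx₃, div_mul_cancel₀ _ hP₃.ne']
  have eA₂' : A₂' = x₂' * Q₂ := by rw [← hx₂', div_mul_cancel₀ _ hQ₂.ne']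
  have eA₃' : A₃' = x₃' * Q₃ := by rw [← hx₃', div_mul_cancel₀ _ hQ₃.ne']
  have eB₀ : B₀ = y₀ * P₀ := by rw [← hy₀, div_mul_cancel₀ _ hP₀.ne']
  have eB₁ : B₁ = y₁ * P₁ := by rw [← hy₁, div_mul_cancel₀ _ hP₁.ne']
  have eB₂ : B₂ = y₂ * P₂ := by rw [← hy₂, div_mul_cancel₀ _ hP₂.ne']
  have eB₃ : B₃ = y₃ * P₃ := by rw [← hy₃, div_mul_cancel₀ _ hP₃.ne']
  have eB₂' : B₂' = y₂' * Q₂ := by rw [← hy₂', div_mul_cancel₀ _ hQ₂.ne']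
  have eB₃' : B₃' = y₃' * Q₃ := by rw [← hy₃', div_mul_cancel₀ _ hQ₃.ne']
  clear hx₀ hx₁ hx₂ hx₃ hx₂' hx₃' hy₀ hy₁ hy₂ hy₃ hy₂' hy₃'
  subst eA₀ eA₁ eA₂ eA₃ eA₂' eA₃' eB₀ eB₁ eB₂ eB₃ eB₂' eB₃'
  -- order relations of the means (cancel the positive masses)
  have hx₂₀ : x₂ ≤ x₀ := le_of_mul_le_mul_right (by linarith only [hA₀₂]) (mul_pos hP₀ hP₂)
  have hx₃₁ : x₃ ≤ x₁ := le_of_mul_le_mul_right (by linarith only [hA₁₃]) (mul_pos hP₁ hP₃)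
  have hx₃₂ : x₃ ≤ x₂ := le_of_mul_le_mul_right (by linarith only [hA₂₃]) (mul_pos hP₂ hP₃)
  have hx₂'₂ : x₂' ≤ x₂ := le_of_mul_le_mul_right (by linarith only [hA₂']) (mul_pos hQ₂ hP₂)
  have hx₃'₃ : x₃' ≤ x₃ := le_of_mul_le_mul_right (by linarith only [hA₃']) (mul_pos hQ₃ hP₃)
  have hy₂₀ : y₂ ≤ y₀ := le_of_mul_le_mul_right (by linarith only [hB₀₂]) (mul_pos hP₀ hP₂)
  have hy₃₁ : y₃ ≤ y₁ := le_of_mul_le_mul_right (by linarith only [hB₁₃]) (mul_pos hP₁ hP₃)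
  have hy₃₂ : y₃ ≤ y₂ := le_of_mul_le_mul_right (by linarith only [hB₂₃]) (mul_pos hP₂ hP₃)
  have hy₂'₂ : y₂' ≤ y₂ := le_of_mul_le_mul_right (by linarith only [hB₂']) (mul_pos hQ₂ hP₂)
  have hy₃'₃ : y₃' ≤ y₃ := le_of_mul_le_mul_right (by linarith only [hB₃']) (mul_pos hQ₃ hP₃)
  clear hA₀₂ hA₁₃ hA₂₃ hA₂' hA₃' hB₀₂ hB₁₃ hB₂₃ hB₂' hB₃'
  -- covariances in divided form
  obtain ⟨c₀, hc₀⟩ : ∃ c : R, C₀ = (c + x₀ * y₀) * P₀ :=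
    ⟨C₀ / P₀ - x₀ * y₀, by rw [sub_add_cancel, div_mul_cancel₀ _ hP₀.ne']⟩
  obtain ⟨c₁, hc₁⟩ : ∃ c : R, C₁ = (c + x₁ * y₁) * P₁ :=
    ⟨C₁ / P₁ - x₁ * y₁, by rw [sub_add_cancel, div_mul_cancel₀ _ hP₁.ne']⟩
  obtain ⟨c₂, hc₂⟩ : ∃ c : R, C₂' = (c + x₂' * y₂') * Q₂ :=
    ⟨C₂' / Q₂ - x₂' * y₂', by rw [sub_add_cancel, div_mul_cancel₀ _ hQ₂.ne']⟩
  obtain ⟨c₃, hc₃⟩ : ∃ c : R, C₃' = (c + x₃' * y₃') * Q₃ :=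
    ⟨C₃' / Q₃ - x₃' * y₃', by rw [sub_add_cancel, div_mul_cancel₀ _ hQ₃.ne']⟩
  subst hc₀ hc₁ hc₂ hc₃
  have hc₀n : 0 ≤ c₀ :=
    (mul_nonneg_iff_of_pos_right (mul_pos hP₀ hP₀)).mp (by linarith only [hcov₀])
  have hc₁n : 0 ≤ c₁ :=
    (mul_nonneg_iff_of_pos_right (mul_pos hP₁ hP₁)).mp (by linarith only [hcov₁])
  have hc₂n : 0 ≤ c₂ :=
    (mul_nonneg_iff_of_pos_right (mul_pos hQ₂ hQ₂)).mp (by linarith only [hcov₂'])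
  have hc₃n : 0 ≤ c₃ :=
    (mul_nonneg_iff_of_pos_right (mul_pos hQ₃ hQ₃)).mp (by linarith only [hcov₃'])
  clear hcov₀ hcov₁ hcov₂' hcov₃'
  -- the pivotal weights `ρ = Q / P`
  obtain ⟨ρ₂, hρ₂⟩ : ∃ r : R, Q₂ = r * P₂ := ⟨Q₂ / P₂, by rw [div_mul_cancel₀ _ hP₂.ne']⟩
  obtain ⟨ρ₃, hρ₃⟩ : ∃ r : R, Q₃ = r * P₃ := ⟨Q₃ / P₃, by rw [div_mul_cancel₀ _ hP₃.ne']⟩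
  subst hρ₂ hρ₃
  have hρ₂n : 0 ≤ ρ₂ := (mul_nonneg_iff_of_pos_right hP₂).mp hQ₂.le
  have hρ₃₁ : ρ₃ ≤ 1 := le_of_mul_le_mul_right (by linarith only [hQ₃P]) hP₃
  have hρ₂₃ : ρ₂ ≤ ρ₃ := le_of_mul_le_mul_right (by linarith only [hρ]) (mul_pos hP₂ hP₃)
  clear hQ₃P hρ hQ₂ hQ₃
  exact twoPendant_core hℓ₀ hℓ₁ hℓ₂ hℓ₃ hP₀ hP₁ hP₂ hP₃ hΛ hρ₂n hρ₂₃ hρ₃₁ hc₀n hc₁n hc₂n hc₃n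
    hx₂₀ hx₃₁ hx₃₂ hx₂'₂ hx₃'₃ hy₂₀ hy₃₁ hy₃₂ hy₂'₂ hy₃'₃ hPAN hshA hshB hPAU

end TwoPendantAlg

end Summit.Ventures.PercRepro2.Coin
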